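import Summits.AtomisticToContinuum.Crystallization.Theorems.FrustratedLawDichotomyTwoShellRigidityDoor

/-!
# FrustratedLawDichotomy · crux `AperiodicFrustratedLawGap` (stmt-AtomisticToContinuum-27623) — THE TWO-SHELL DOOR WITH PARAMETERS:
# `Price(θ) ∧ KR2(θ, η) ⟹ FDG` for every bond tolerance `0 < θ ≤ 1/100` and fit tolerance `η < 1/20` (decomp-a2c, prover hand 2, gen 8;
# critic rows 401 (3) / 404 (2): «θ and η as PARAMETERS; registered literal θ = 1/100, fallback θ = 1/200»)

`FrustratedLawDichotomyTwoShellRigidityDoor` (p817755) fixes the literals `θ = 1/100`, `η < 1/20` (existential `η`).  Here both are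
parameters:

* `KR2 θ η` (hypothesis `h2`, inline, def-free): two-shell charge-free(θ) sites (the site AND its `θ`-bonded neighbours are `IsChargeFree θ`)
  have their bonded dozen, bijectively pattern-indexed, within `η·nn_i` of `nn_i·A(fcc or hcp pattern)` for some linear isometry `A`.
* `Price θ` (hypothesis `hprice`, inline): `∃ κ > 0, κ·#charged_θ(y) ≤ U(y) − N·e⋆` for all finite injective `y` — for `θ = 1/100` this is
  `ChargedEnergyGap` (item 14231) by `chargedEnergyGap_iff_price`; for `θ = 1/200` it is the fallback item the planner would file.
* `robustGood_of_shape_tol` : p816649's transfer with tolerance `θ ≤ 1/100` (KR_gap's constant `100/101 ≤ 1/(1+θ)`);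
  `card_adj_le_tol` (bond degree `≤ 29` for `θ ≤ 1/100`); `card_le_good_add_tol` (`N ≤ #good + 30·#charged_θ`);
* `frustrationDensityGap_of_price_of_kr2` : `0 < θ ≤ 1/100 → η < 1/20 → Price θ → KR2 θ η → FDG` (`κ' = C = κ/30`);
  `frustrationDensityGap_of_chargedEnergyGap_of_kr2` : the registered instance `θ = 1/100` from `ChargedEnergyGap`;
  by name: `aperiodicFrustratedLawGap_…` (crux, given `MuEquilibriumDoor`), `aperiodicErgodicGap_…` (REGISTERED STUB verbatim),
  `noFrustratedPeriodicMinimiser_…` (26654, door-free), all θ-parametric.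
`[folklore]` bookkeeping; no definitions, no `sorry`.
-/

noncomputable section

namespace Summit.AtomisticToContinuum.Crystallization.Theorems.FrustratedLawDichotomyTwoShellRigidityDoorTol

open Literature.Geometry.DiscreteGeometry
open Literature.MathematicalPhysics.StatisticalMechanics
open Summit.AtomisticToContinuum.Crystallization.Theses.PricedLinkCensus (ChargedEnergyGap)
open Summit.AtomisticToContinuum.Crystallization.Theorems.ChargedEnergyGapNegative (E3 eStar charged chargedEnergyGap_iff_price)
open Summit.AtomisticToContinuum.Crystallization.Theorems.FrustratedLawDichotomyThirteenthNeighbourGap (thirteenth_neighbour_gap_fcc)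
open Summit.AtomisticToContinuum.Crystallization.Theorems.FrustratedLawDichotomyThirteenthNeighbourGapHcp (thirteenth_neighbour_gap_hcp)
open Summit.AtomisticToContinuum.Crystallization.Theorems.FrustratedLawDichotomyFrustrationDensityGapDoor
  (aperiodicFrustratedLawGap_of_frustrationDensityGap aperiodicErgodicGap_of_frustrationDensityGap)
open Summit.AtomisticToContinuum.Crystallization.Theorems.FrustratedLawDichotomyLocalCloseOrderPeriodic
  (noFrustratedPeriodicMinimiser_of_frustrationDensityGap)

/-- **The transfer for one pattern at bond tolerance `θ ≤ 1/100`** (p816649's `robustGood_of_shape` with `1/100 ↦ θ`): site `i` with its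
`θ`-bonded dozen indexed by `τ : Pat → Fin N` within `η·d` of `d·A(Pat)`, `d = nn_i`, `η < 1/20`, KR_gap for `Pat` ⟹ `y i` is robustly good
in `range y` with data `(d, η, d/100, A, y ∘ τ)` (a non-bonded atom in the gap annulus would be within `(100/101)d ≤ d/(1+θ) ≤ nn` of a shell
atom). [folklore] -/
theorem robustGood_of_shape_tol {θ : ℝ} (hθ0 : 0 < θ) (hθ1 : θ ≤ 1 / 100) {N : ℕ} {y : Fin N → EuclideanSpace ℝ (Fin 3)} (hy : Function.Injective y)
    (hsep : ∀ a b : Fin N, a ≠ b → (7 : ℝ) / 10 ≤ dist (y a) (y b)) {i : Fin N}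
    {Pat : Finset (EuclideanSpace ℝ (Fin 3))}
    (hgap : ∀ {p q : EuclideanSpace ℝ (Fin 3)} {d η : ℝ} {A : EuclideanSpace ℝ (Fin 3) →ₗᵢ[ℝ] EuclideanSpace ℝ (Fin 3)} {t : ↥Pat → EuclideanSpace ℝ (Fin 3)}, 0 < d → η ≤ 1 / 20 →
      (∀ u : ↥Pat, ‖(t u - p) - d • A (u : EuclideanSpace ℝ (Fin 3))‖ ≤ η * d) → d ≤ dist q p → dist q p ≤ 131 / 100 * d → ∃ u : ↥Pat, dist q (t u) < 100 / 101 * d)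
    {η : ℝ} {A : EuclideanSpace ℝ (Fin 3) →ₗᵢ[ℝ] EuclideanSpace ℝ (Fin 3)} {τ : ↥Pat → Fin N} (hη : η < 1 / 20)
    (hτ₁ : ∀ u : ↥Pat, (bondGraph θ y).Adj i (τ u))
    (hτ₂ : ∀ k : Fin N, (bondGraph θ y).Adj i k → ∃ u : ↥Pat, τ u = k)
    (hfit : ∀ u : ↥Pat, ‖(y (τ u) - y i) - nearestDist y i • A (u : EuclideanSpace ℝ (Fin 3))‖ ≤ η * nearestDist y i)
    (hPat : Pat.Nonempty) :
    0 < (nearestDist y i) ∧ 0 < (nearestDist y i / 100) ∧ η < 1 / 20 ∧ (∀ u : ↥Pat, (fun u => y (τ u)) u ∈ (Set.range y) ∧ ‖((fun u => y (τ u)) u - (y i)) - (nearestDist y i) • A (u : EuclideanSpace ℝ (Fin 3))‖ ≤ η * (nearestDist y i)) ∧ (∀ s : EuclideanSpace ℝ (Fin 3), s ∈ (Set.range y) → s ≠ (y i) → (nearestDist y i) ≤ dist s (y i)) ∧ (∃ s : EuclideanSpace ℝ (Fin 3), s ∈ (Set.range y) ∧ s ≠ (y i) ∧ dist s (y i) ≤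 (nearestDist y i)) ∧ (∀ s : EuclideanSpace ℝ (Fin 3), s ∈ (Set.range y) → s ≠ (y i) → dist s (y i) < 13 / 10 * (nearestDist y i) + (nearestDist y i / 100) → dist s (y i) ≤ 13 / 10 * (nearestDist y i) - (nearestDist y i / 100) ∧ s ∈ Set.range (fun u => y (τ u))) := by
  obtain ⟨u₀, hu₀⟩ := hPat
  have hki : τ ⟨u₀, hu₀⟩ ≠ i := fun h => (bondGraph_adj.1 (hτ₁ ⟨u₀, hu₀⟩)).1 h.symm
  -- the scale
  have hd : (7 : ℝ) / 10 ≤ nearestDist y i :=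
    le_nearestDist ⟨_, hki⟩ fun k hk => hsep i k (fun h => hk h.symm)
  have hd0 : 0 < nearestDist y i := by linarith
  -- bonded neighbours: distance `≤ 101/100·d`, own scale `≥ 100/101·d`
  have hbond : ∀ k : Fin N, (bondGraph θ y).Adj i k →
      dist (y i) (y k) ≤ (1 + θ) * nearestDist y i ∧ dist (y i) (y k) ≤ (1 + θ) * nearestDist y k := by
    intro k hk
    obtain ⟨-, hle⟩ := bondGraph_adj.1 hk
    exact ⟨hle.trans (mul_le_mul_of_nonneg_left (min_le_left _ _) (by linarith)),
      hle.trans (mul_le_mul_of_nonneg_left (min_le_right _ _) (by linarith))⟩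
  refine ⟨hd0, by positivity, hη, fun u => ⟨⟨τ u, rfl⟩, hfit u⟩, ?_, ?_, ?_⟩
  · -- `d ≤ dist s (y i)` for every other atom
    rintro _ ⟨k, rfl⟩ hk
    rw [dist_comm]
    exact nearestDist_le_dist y fun h => hk (by rw [h])
  · -- attained
    obtain ⟨k, hk, hkd⟩ := exists_nearestDist_eq_dist y ⟨_, hki⟩
    exact ⟨y k, ⟨k, rfl⟩, fun h => hk (hy h), by rw [dist_comm, ← hkd]⟩
  · -- the clean gap at `13/10·d ± d/100`
    rintro _ ⟨k, rfl⟩ hk hlt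
    have hki' : k ≠ i := fun h => hk (by rw [h])
    by_cases hadj : (bondGraph θ y).Adj i k
    · obtain ⟨u, rfl⟩ := hτ₂ k hadj
      refine ⟨?_, ⟨u, rfl⟩⟩
      have := (hbond _ hadj).1
      have h5 : (1 + θ) * nearestDist y i ≤ (101 / 100) * nearestDist y i :=
        mul_le_mul_of_nonneg_right (by linarith) hd0.le
      rw [dist_comm] at this
      linarith
    · exfalso
      have hge : nearestDist y i ≤ dist (y k) (y i) := by
        rw [dist_comm]; exact nearestDist_le_dist y hki'
      obtain ⟨u, hu⟩ := hgap hd0 hη.le hfit hge (by linarith)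
      -- `τ u` is bonded to `i`, `k` is not: they differ, so `dist ≥ nn_(τ u) ≥ 100/101·d`
      have hne : k ≠ τ u := fun h => hadj (h ▸ hτ₁ u)
      have h1 : nearestDist y (τ u) ≤ dist (y (τ u)) (y k) := nearestDist_le_dist y hne
      have h2 := (hbond _ (hτ₁ u)).2
      have h3 : nearestDist y i ≤ dist (y i) (y (τ u)) :=
        nearestDist_le_dist y (fun h => (bondGraph_adj.1 (hτ₁ u)).1 h.symm)
      have h4 : (1 + θ) * nearestDist y (τ u) ≤ (101 / 100) * nearestDist y (τ u) :=
        mul_le_mul_of_nonneg_right (by linarith) (nearestDist_nonneg _ _)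
      rw [dist_comm] at hu
      linarith


/-- **`KR2(θ, η) ⟹` two-shell charge-free(θ) sites are robustly good** (`0 < θ ≤ 1/100`, `η < 1/20`). [folklore] -/
theorem robustGood_of_twoShell_tol {θ η : ℝ} (hθ0 : 0 < θ) (hθ1 : θ ≤ 1 / 100) (hη : η < 1 / 20)
    (h2 : ∀ (N : ℕ) (y : Fin N → EuclideanSpace ℝ (Fin 3)), Function.Injective y → (∀ a b : Fin N, a ≠ b → (7 : ℝ) / 10 ≤ dist (y a) (y b)) → ∀ i : Fin N, Literature.Geometry.DiscreteGeometry.IsChargeFree θ y i → (∀ j : Fin N, (Literature.Geometry.DiscreteGeometry.bondGraph θ y).Adj i j → Literature.Geometry.DiscreteGeometry.IsChargeFree θ y j) → ∃ A : EuclideanSpace ℝ (Fin 3) →ₗᵢ[ℝ] EuclideanSpace ℝ (Fin 3), ((∃ τ : ↥Literature.Geometry.DiscreteGeometry.fccKissingPattern → Fin N, (∀ u : ↥Literature.Geometry.DiscreteGeometry.fccKissingPattern, (Literature.Geometry.DiscreteGeometry.bondGraph θ y).Adj i (τ u)) ∧ (∀ k : Fin N, (Literature.Geometry.DiscreteGeometry.bondGraph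 θ y).Adj i k → ∃ u : ↥Literature.Geometry.DiscreteGeometry.fccKissingPattern, τ u = k) ∧ (∀ u : ↥Literature.Geometry.DiscreteGeometry.fccKissingPattern, ‖(y (τ u) - y i) - Literature.Geometry.DiscreteGeometry.nearestDist y i • A (u : EuclideanSpace ℝ (Fin 3))‖ ≤ η * Literature.Geometry.DiscreteGeometry.nearestDist y i)) ∨ (∃ τ : ↥Literature.Geometry.DiscreteGeometry.hcpKissingPattern → Fin N, (∀ u : ↥Literature.Geometry.DiscreteGeometry.hcpKissingPattern, (Literature.Geometry.DiscreteGeometry.bondGraph θ y).Adj i (τ u)) ∧ (∀ k : Fin N, (Literature.Geometry.DiscreteGeometry.bondGraph θ y).Adj i k → ∃ u : ↥Literature.Geometry.DiscreteGeometry.hcpKissingPattern, τ u = k) ∧ (∀ u : ↥Literature.Geometry.DiscreteGeometry.hcpKissingPattern, ‖(y (τ u) - y i) - Literature.Geometry.DiscreteGeometry.nearestDist y i • A (u : EuclideanSpace ℝ (Fin 3))‖ ≤ η * Literature.Geometry.DiscreteGeometry.nearestDist y i)))) :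
    ∀ (N : ℕ) (y : Fin N → EuclideanSpace ℝ (Fin 3)), Function.Injective y → (∀ a b : Fin N, a ≠ b → (7 : ℝ) / 10 ≤ dist (y a) (y b)) →
      ∀ i : Fin N, Literature.Geometry.DiscreteGeometry.IsChargeFree θ y i →
        (∀ j : Fin N, (Literature.Geometry.DiscreteGeometry.bondGraph θ y).Adj i j → Literature.Geometry.DiscreteGeometry.IsChargeFree θ y j) →
        ∃ (d η γ : ℝ) (A : EuclideanSpace ℝ (Fin 3) →ₗᵢ[ℝ] EuclideanSpace ℝ (Fin 3)), (∃ t : ↥Literature.Geometry.DiscreteGeometry.fccKissingPattern → EuclideanSpace ℝ (Fin 3), 0 < d ∧ 0 < γ ∧ η < 1 / 20 ∧ (∀ u : ↥Literature.Geometry.DiscreteGeometry.fccKissingPattern, t u ∈ (Set.range y) ∧ ‖(t u - (y i)) - d • A (u : EuclideanSpace ℝ (Fin 3))‖ ≤ η * d) ∧ (∀ s : EuclideanSpace ℝ (Fin 3), s ∈ (Set.range y) → s ≠ (y i) → d ≤ dist s (y i)) ∧ (∃ s : EuclideanSpace ℝ (Fin 3), s ∈ (Set.range y) ∧ s ≠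 (y i) ∧ dist s (y i) ≤ d) ∧ (∀ s : EuclideanSpace ℝ (Fin 3), s ∈ (Set.range y) → s ≠ (y i) → dist s (y i) < 13 / 10 * d + γ → dist s (y i) ≤ 13 / 10 * d - γ ∧ s ∈ Set.range t)) ∨ (∃ t : ↥Literature.Geometry.DiscreteGeometry.hcpKissingPattern → EuclideanSpace ℝ (Fin 3), 0 < d ∧ 0 < γ ∧ η < 1 / 20 ∧ (∀ u : ↥Literature.Geometry.DiscreteGeometry.hcpKissingPattern, t u ∈ (Set.range y) ∧ ‖(t u - (y i)) - d • A (u : EuclideanSpace ℝ (Fin 3))‖ ≤ η * d) ∧ (∀ s : EuclideanSpace ℝ (Fin 3), s ∈ (Set.range y) → s ≠ (y i) → d ≤ dist s (y i)) ∧ (∃ s : EuclideanSpace ℝ (Fin 3), s ∈ (Set.range y) ∧ s ≠ (y i) ∧ dist s (y i) ≤ d) ∧ (∀ s : EuclideanSpace ℝ (Fin 3), s ∈ (Set.range y) → s ≠ (y i) → dist s (y i) < 13 / 10 * d + γ → dist s (y i) ≤ 13 / 10 * d - γ ∧ s ∈ Set.range t)) := by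
  intro N y hy hsep i hcf hcf2
  obtain ⟨A, hcase⟩ := h2 N y hy hsep i hcf hcf2
  rcases hcase with ⟨τ, hτ₁, hτ₂, hfit⟩ | ⟨τ, hτ₁, hτ₂, hfit⟩
  · exact ⟨nearestDist y i, η, nearestDist y i / 100, A, Or.inl ⟨fun u => y (τ u),
      robustGood_of_shape_tol hθ0 hθ1 hy hsep (fun hd hη ht h1 h2 => thirteenth_neighbour_gap_fcc hd hη ht h1 h2) hη hτ₁ hτ₂ hfit
        (Finset.card_pos.1 (by rw [card_fccKissingPattern]; norm_num))⟩⟩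
  · exact ⟨nearestDist y i, η, nearestDist y i / 100, A, Or.inr ⟨fun u => y (τ u),
      robustGood_of_shape_tol hθ0 hθ1 hy hsep (fun hd hη ht h1 h2 => thirteenth_neighbour_gap_hcp hd hη ht h1 h2) hη hτ₁ hτ₂ hfit
        (Finset.card_pos.1 (by rw [card_hcpKissingPattern]; norm_num))⟩⟩

/-- **Bond degrees at tolerance `θ ≤ 1/100` are `≤ 29`** (neighbours lie within `(1+θ)·nn_j`, pairwise `≥ nn_j/(1+θ)`;
`(2(1+θ)² + 1)³ ≤ (2·1.01² + 1)³ < 29`). [folklore] -/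
theorem card_adj_le_tol {θ : ℝ} (hθ0 : 0 < θ) (hθ1 : θ ≤ 1 / 100) {N : ℕ} {y : Fin N → EuclideanSpace ℝ (Fin 3)}
    (hy : Function.Injective y) (hsep : ∀ a b : Fin N, a ≠ b → (7 : ℝ) / 10 ≤ dist (y a) (y b)) (j : Fin N) :
    (Nat.card {i : Fin N // (bondGraph θ y).Adj i j} : ℝ) ≤ 29 := by
  classical
  rw [Nat.card_eq_fintype_card, Fintype.card_subtype]
  set S := Finset.univ.filter fun i : Fin N => (bondGraph θ y).Adj i j with hS
  rcases S.eq_empty_or_nonempty with hS0 | ⟨i₀, hi₀⟩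
  · simp [hS0]
  have hi₀j : i₀ ≠ j := (bondGraph_adj.1 (Finset.mem_filter.1 hi₀).2).1
  have hnn : (7 : ℝ) / 10 ≤ nearestDist y j := le_nearestDist ⟨i₀, hi₀j⟩ fun k hk => hsep j k (fun h => hk h.symm)
  have hnn0 : 0 < nearestDist y j := by linarith
  have h1θ : 0 < 1 + θ := by linarith
  set s : Finset (EuclideanSpace ℝ (Fin 3)) := S.image y with hs
  have hcard : s.card = S.card := Finset.card_image_of_injective S hy
  have hmem : ∀ c ∈ s, ∃ i, (bondGraph θ y).Adj i j ∧ y i = c := by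
    intro c hc
    obtain ⟨i, hi, rfl⟩ := Finset.mem_image.1 hc
    exact ⟨i, (Finset.mem_filter.1 hi).2, rfl⟩
  have hadj : ∀ i, (bondGraph θ y).Adj i j →
      dist (y i) (y j) ≤ (1 + θ) * nearestDist y j ∧ nearestDist y j / (1 + θ) ≤ nearestDist y i := by
    intro i hi
    obtain ⟨hij, hle⟩ := bondGraph_adj.1 hi
    have h1 : dist (y i) (y j) ≤ (1 + θ) * nearestDist y j := hle.trans (mul_le_mul_of_nonneg_left (min_le_right _ _) h1θ.le)
    have h2 : dist (y i) (y j) ≤ (1 + θ) * nearestDist y i := hle.trans (mul_le_mul_of_nonneg_left (min_le_left _ _) h1θ.le)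
    have h3 : nearestDist y j ≤ dist (y i) (y j) := by rw [dist_comm]; exact nearestDist_le_dist y hij
    refine ⟨h1, ?_⟩
    rw [div_le_iff₀ h1θ]
    linarith
  have hR : ∀ c ∈ s, dist c (y j) ≤ (1 + θ) * nearestDist y j := by
    intro c hc
    obtain ⟨i, hi, rfl⟩ := hmem c hc
    exact (hadj i hi).1
  have hr : ∀ c ∈ s, ∀ d ∈ s, c ≠ d → nearestDist y j / (1 + θ) ≤ dist c d := by
    intro c hc d hd hcd
    obtain ⟨i, hi, rfl⟩ := hmem c hc
    obtain ⟨i', hi', rfl⟩ := hmem d hd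
    have hii' : i' ≠ i := fun h => hcd (by rw [h])
    exact (hadj i hi).2.trans (nearestDist_le_dist y hii')
  have hpack := card_le_of_separated_of_dist_le s (y j) (by positivity) (by positivity) hR hr
  rw [finrank_euclideanSpace, Fintype.card_fin, hcard] at hpack
  have hq : (2 * ((1 + θ) * nearestDist y j) / (nearestDist y j / (1 + θ)) + 1 : ℝ) = 2 * (1 + θ) ^ 2 + 1 := by
    field_simp
  rw [hq] at hpack
  have hθ2 : (1 + θ) ^ 2 ≤ (101 / 100 : ℝ) ^ 2 := pow_le_pow_left₀ h1θ.le (by linarith) 2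
  have hb : ((2 : ℝ) * (1 + θ) ^ 2 + 1) ^ 3 ≤ (2 * (101 / 100) ^ 2 + 1) ^ 3 :=
    pow_le_pow_left₀ (by positivity) (by linarith) 3
  have : ((2 : ℝ) * (101 / 100) ^ 2 + 1) ^ 3 ≤ 29 := by norm_num
  exact hpack.trans (hb.trans this)

/-- **Counting at tolerance `θ`**: if every two-shell charge-free(θ) site is good, then `N ≤ #good + 30·#charged_θ`. [folklore] -/
theorem card_le_good_add_tol {θ : ℝ} (hθ0 : 0 < θ) (hθ1 : θ ≤ 1 / 100) {N : ℕ} {y : Fin N → EuclideanSpace ℝ (Fin 3)}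
    (hy : Function.Injective y) (hsep : ∀ a b : Fin N, a ≠ b → (7 : ℝ) / 10 ≤ dist (y a) (y b)) {good : Fin N → Prop}
    (hgood : ∀ i : Fin N, IsChargeFree θ y i →
      (∀ j : Fin N, (bondGraph θ y).Adj i j → IsChargeFree θ y j) → good i) :
    (N : ℝ) ≤ (Nat.card {i : Fin N // good i} : ℝ) + 30 * (charged θ y : ℝ) := by
  classical
  set G := bondGraph θ y with hG
  set TS : Finset (Fin N) := Finset.univ.filter fun i =>
    IsChargeFree θ y i ∧ ∀ j : Fin N, G.Adj i j → IsChargeFree θ y j with hTS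
  set NTS : Finset (Fin N) := Finset.univ.filter fun i =>
    ¬ (IsChargeFree θ y i ∧ ∀ j : Fin N, G.Adj i j → IsChargeFree θ y j) with hNTS
  set CH : Finset (Fin N) := Finset.univ.filter fun i => ¬ IsChargeFree θ y i with hCH
  set B : Finset (Fin N) := Finset.univ.filter fun i => ∃ j : Fin N, G.Adj i j ∧ ¬ IsChargeFree θ y j with hB
  set GD : Finset (Fin N) := Finset.univ.filter fun i => good i with hGD
  have hsplit : TS.card + NTS.card = N := by
    have h := Finset.card_filter_add_card_filter_not (s := (Finset.univ : Finset (Fin N)))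
      (fun i : Fin N => IsChargeFree θ y i ∧ ∀ j : Fin N, G.Adj i j → IsChargeFree θ y j)
    rwa [Finset.card_univ, Fintype.card_fin] at h
  have h1 : TS.card ≤ GD.card :=
    Finset.card_le_card (Finset.monotone_filter_right _ fun i _ hi => hgood i hi.1 hi.2)
  have hGD' : (Nat.card {i : Fin N // good i} : ℝ) = GD.card := by
    rw [Nat.card_eq_fintype_card, Fintype.card_subtype]
  have hCH' : (charged θ y : ℝ) = CH.card := by
    unfold charged
    rw [Nat.card_eq_fintype_card, Fintype.card_subtype]
  have h2 : NTS.card ≤ CH.card + B.card := by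
    refine (Finset.card_le_card ?_).trans (Finset.card_union_le _ _)
    intro i hi
    rw [Finset.mem_union]
    have hi' := (Finset.mem_filter.1 hi).2
    by_cases hc : IsChargeFree θ y i
    · right
      refine Finset.mem_filter.2 ⟨Finset.mem_univ _, ?_⟩
      by_contra hne
      push Not at hne
      exact hi' ⟨hc, fun j hj => hne j hj⟩
    · left
      exact Finset.mem_filter.2 ⟨Finset.mem_univ _, hc⟩
  have h3 : (B.card : ℝ) ≤ 29 * CH.card := by
    have hsub : B ⊆ CH.biUnion fun j => Finset.univ.filter fun i : Fin N => G.Adj i j := by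
      intro i hi
      obtain ⟨j, hij, hj⟩ := (Finset.mem_filter.1 hi).2
      exact Finset.mem_biUnion.2 ⟨j, Finset.mem_filter.2 ⟨Finset.mem_univ _, hj⟩, Finset.mem_filter.2 ⟨Finset.mem_univ _, hij⟩⟩
    have hle := (Finset.card_le_card hsub).trans Finset.card_biUnion_le
    calc (B.card : ℝ) ≤ ((∑ j ∈ CH, (Finset.univ.filter fun i : Fin N => G.Adj i j).card : ℕ) : ℝ) := by exact_mod_cast hle
      _ = ∑ j ∈ CH, ((Finset.univ.filter fun i : Fin N => G.Adj i j).card : ℝ) := by push_cast; rfl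
      _ ≤ ∑ j ∈ CH, (29 : ℝ) := Finset.sum_le_sum fun j _ => by
          have h := card_adj_le_tol hθ0 hθ1 hy hsep j
          rwa [Nat.card_eq_fintype_card, Fintype.card_subtype] at h
      _ = 29 * CH.card := by rw [Finset.sum_const, nsmul_eq_mul, mul_comm]
  have hsplit' : (N : ℝ) = TS.card + NTS.card := by exact_mod_cast hsplit.symm
  have h1' : (TS.card : ℝ) ≤ GD.card := by exact_mod_cast h1
  have h2' : (NTS.card : ℝ) ≤ CH.card + B.card := by exact_mod_cast h2
  rw [hGD', hCH']
  linarith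

/-- **`Price(θ) ∧ KR2(θ, η) ⟹ FDG`** for `0 < θ ≤ 1/100`, `η < 1/20`, with `κ' = C = κ/30`. [folklore] -/
theorem frustrationDensityGap_of_price_of_kr2 {θ η : ℝ} (hθ0 : 0 < θ) (hθ1 : θ ≤ 1 / 100) (hη : η < 1 / 20)
    (hprice : ∃ κ : ℝ, 0 < κ ∧ ∀ (N : ℕ) (y : Fin N → EuclideanSpace ℝ (Fin 3)), Function.Injective y → κ * (charged θ y : ℝ) ≤ interactionEnergy lennardJones y - (N : ℝ) * eStar)
    (h2 : ∀ (N : ℕ) (y : Fin N → EuclideanSpace ℝ (Fin 3)), Function.Injective y → (∀ a b : Fin N, a ≠ b → (7 : ℝ) / 10 ≤ dist (y a) (y b)) → ∀ i : Fin N, Literature.Geometry.DiscreteGeometry.IsChargeFree θ y i → (∀ j : Fin N, (Literature.Geometry.DiscreteGeometry.bondGraph θ y).Adj i j → Literature.Geometry.DiscreteGeometry.IsChargeFree θ y j) → ∃ A : EuclideanSpace ℝ (Fin 3) →ₗᵢ[ℝ] EuclideanSpace ℝ (Fin 3), ((∃ τ : ↥Literature.Geometry.DiscreteGeometry.fccKissingPattern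 → Fin N, (∀ u : ↥Literature.Geometry.DiscreteGeometry.fccKissingPattern, (Literature.Geometry.DiscreteGeometry.bondGraph θ y).Adj i (τ u)) ∧ (∀ k : Fin N, (Literature.Geometry.DiscreteGeometry.bondGraph θ y).Adj i k → ∃ u : ↥Literature.Geometry.DiscreteGeometry.fccKissingPattern, τ u = k) ∧ (∀ u : ↥Literature.Geometry.DiscreteGeometry.fccKissingPattern, ‖(y (τ u) - y i) - Literature.Geometry.DiscreteGeometry.nearestDist y i • A (u : EuclideanSpace ℝ (Fin 3))‖ ≤ η * Literature.Geometry.DiscreteGeometry.nearestDist y i)) ∨ (∃ τ : ↥Literature.Geometry.DiscreteGeometry.hcpKissingPattern → Fin N, (∀ u : ↥Literature.Geometry.DiscreteGeometry.hcpKissingPattern, (Literature.Geometry.DiscreteGeometry.bondGraph θ y).Adj i (τ u)) ∧ (∀ k : Fin N, (Literature.Geometry.DiscreteGeometry.bondGraph θ y).Adj i k → ∃ u : ↥Literature.Geometry.DiscreteGeometry.hcpKissingPattern, τ u = k) ∧ (∀ u : ↥Literature.Geometry.DiscreteGeometry.hcpKissingPattern, ‖(y (τ u) - y i) - Literature.Geometry.DiscreteGeometry.nearestDist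 y i • A (u : EuclideanSpace ℝ (Fin 3))‖ ≤ η * Literature.Geometry.DiscreteGeometry.nearestDist y i)))) :
    ∃ κ : ℝ, 0 < κ ∧ ∃ C : ℝ, ∀ (N : ℕ) (y : Fin N → EuclideanSpace ℝ (Fin 3)), Function.Injective y → (∀ a b : Fin N, a ≠ b → (7 : ℝ) / 10 ≤ dist (y a) (y b)) → κ * N - C * (Nat.card {i : Fin N // ∃ (d η γ : ℝ) (A : EuclideanSpace ℝ (Fin 3) →ₗᵢ[ℝ] EuclideanSpace ℝ (Fin 3)), (∃ t : ↥Literature.Geometry.DiscreteGeometry.fccKissingPattern → EuclideanSpace ℝ (Fin 3), 0 < d ∧ 0 < γ ∧ η < 1 / 20 ∧ (∀ u : ↥Literature.Geometry.DiscreteGeometry.fccKissingPattern, t u ∈ (Set.range y) ∧ ‖(t u - (y i)) - d • A (u : EuclideanSpace ℝ (Fin 3))‖ ≤ η * d) ∧ (∀ s : EuclideanSpace ℝ (Fin 3), s ∈ (Set.range y) → s ≠ (y i) → d ≤ dist s (y i)) ∧ (∃ s : EuclideanSpace ℝ (Fin 3), s ∈ (Set.range y) ∧ s ≠ (y i) ∧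 dist s (y i) ≤ d) ∧ (∀ s : EuclideanSpace ℝ (Fin 3), s ∈ (Set.range y) → s ≠ (y i) → dist s (y i) < 13 / 10 * d + γ → dist s (y i) ≤ 13 / 10 * d - γ ∧ s ∈ Set.range t)) ∨ (∃ t : ↥Literature.Geometry.DiscreteGeometry.hcpKissingPattern → EuclideanSpace ℝ (Fin 3), 0 < d ∧ 0 < γ ∧ η < 1 / 20 ∧ (∀ u : ↥Literature.Geometry.DiscreteGeometry.hcpKissingPattern, t u ∈ (Set.range y) ∧ ‖(t u - (y i)) - d • A (u : EuclideanSpace ℝ (Fin 3))‖ ≤ η * d) ∧ (∀ s : EuclideanSpace ℝ (Fin 3), s ∈ (Set.range y) → s ≠ (y i) → d ≤ dist s (y i)) ∧ (∃ s : EuclideanSpace ℝ (Fin 3), s ∈ (Set.range y) ∧ s ≠ (y i) ∧ dist s (y i) ≤ d) ∧ (∀ s : EuclideanSpace ℝ (Fin 3), s ∈ (Set.range y) → s ≠ (y i) → dist s (y i) < 13 / 10 * d + γ → dist s (y i) ≤ 13 / 10 * d - γ ∧ s ∈ Set.range t))} : ℝ) ≤ Literature.MathematicalPhysics.StatisticalMechanics.interactionEnergy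 Literature.MathematicalPhysics.StatisticalMechanics.lennardJones y - N * (⨅ Q : Literature.MathematicalPhysics.StatisticalMechanics.PeriodicConfiguration 3, Q.energyPerParticle Literature.MathematicalPhysics.StatisticalMechanics.lennardJones) := by
  classical
  obtain ⟨κ, hκ, hprice⟩ := hprice
  refine ⟨κ / 30, by positivity, κ / 30, fun N y hy hsep => ?_⟩
  have hp := hprice N y hy
  have hc := card_le_good_add_tol hθ0 hθ1 hy hsep (robustGood_of_twoShell_tol hθ0 hθ1 hη h2 N y hy hsep)
  have hκ' : (0 : ℝ) ≤ κ / 30 := by positivity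
  have hc' := mul_le_mul_of_nonneg_left hc hκ'
  show _ ≤ interactionEnergy lennardJones y - (N : ℝ) * eStar
  nlinarith [hc', hp]

/-- **The registered instance `θ = 1/100`**: `ChargedEnergyGap (14231) ∧ KR2(1/100, η) ⟹ FDG` for every `η < 1/20`. [folklore] -/
theorem frustrationDensityGap_of_chargedEnergyGap_of_kr2 {η : ℝ} (hη : η < 1 / 20) (hgap : ChargedEnergyGap)
    (h2 : ∀ (N : ℕ) (y : Fin N → EuclideanSpace ℝ (Fin 3)), Function.Injective y → (∀ a b : Fin N, a ≠ b → (7 : ℝ) / 10 ≤ dist (y a) (y b)) → ∀ i : Fin N, Literature.Geometry.DiscreteGeometry.IsChargeFree (1 / 100 : ℝ) y i → (∀ j : Fin N, (Literature.Geometry.DiscreteGeometry.bondGraph (1 / 100 : ℝ) y).Adj i j → Literature.Geometry.DiscreteGeometry.IsChargeFree (1 / 100 : ℝ) y j) → ∃ A : EuclideanSpace ℝ (Fin 3) →ₗᵢ[ℝ] EuclideanSpace ℝ (Fin 3), ((∃ τ : ↥Literature.Geometry.DiscreteGeometry.fccKissingPattern → Fin N, (∀ u : ↥Literature.Geometry.DiscreteGeometry.fccKissingPattern,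 (Literature.Geometry.DiscreteGeometry.bondGraph (1 / 100 : ℝ) y).Adj i (τ u)) ∧ (∀ k : Fin N, (Literature.Geometry.DiscreteGeometry.bondGraph (1 / 100 : ℝ) y).Adj i k → ∃ u : ↥Literature.Geometry.DiscreteGeometry.fccKissingPattern, τ u = k) ∧ (∀ u : ↥Literature.Geometry.DiscreteGeometry.fccKissingPattern, ‖(y (τ u) - y i) - Literature.Geometry.DiscreteGeometry.nearestDist y i • A (u : EuclideanSpace ℝ (Fin 3))‖ ≤ η * Literature.Geometry.DiscreteGeometry.nearestDist y i)) ∨ (∃ τ : ↥Literature.Geometry.DiscreteGeometry.hcpKissingPattern → Fin N, (∀ u : ↥Literature.Geometry.DiscreteGeometry.hcpKissingPattern, (Literature.Geometry.DiscreteGeometry.bondGraph (1 / 100 : ℝ) y).Adj i (τ u)) ∧ (∀ k : Fin N, (Literature.Geometry.DiscreteGeometry.bondGraph (1 / 100 : ℝ) y).Adj i k → ∃ u : ↥Literature.Geometry.DiscreteGeometry.hcpKissingPattern, τ u = k) ∧ (∀ u : ↥Literature.Geometry.DiscreteGeometry.hcpKissingPattern, ‖(y (τ u) - y i) - Literature.Geometry.DiscreteGeometry.nearestDist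 y i • A (u : EuclideanSpace ℝ (Fin 3))‖ ≤ η * Literature.Geometry.DiscreteGeometry.nearestDist y i)))) :
    ∃ κ : ℝ, 0 < κ ∧ ∃ C : ℝ, ∀ (N : ℕ) (y : Fin N → EuclideanSpace ℝ (Fin 3)), Function.Injective y → (∀ a b : Fin N, a ≠ b → (7 : ℝ) / 10 ≤ dist (y a) (y b)) → κ * N - C * (Nat.card {i : Fin N // ∃ (d η γ : ℝ) (A : EuclideanSpace ℝ (Fin 3) →ₗᵢ[ℝ] EuclideanSpace ℝ (Fin 3)), (∃ t : ↥Literature.Geometry.DiscreteGeometry.fccKissingPattern → EuclideanSpace ℝ (Fin 3), 0 < d ∧ 0 < γ ∧ η < 1 / 20 ∧ (∀ u : ↥Literature.Geometry.DiscreteGeometry.fccKissingPattern, t u ∈ (Set.range y) ∧ ‖(t u - (y i)) - d • A (u : EuclideanSpace ℝ (Fin 3))‖ ≤ η * d) ∧ (∀ s : EuclideanSpace ℝ (Fin 3), s ∈ (Set.range y) → s ≠ (y i) → d ≤ dist s (y i)) ∧ (∃ s : EuclideanSpace ℝ (Fin 3), s ∈ (Set.range y) ∧ s ≠ (y i) ∧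 dist s (y i) ≤ d) ∧ (∀ s : EuclideanSpace ℝ (Fin 3), s ∈ (Set.range y) → s ≠ (y i) → dist s (y i) < 13 / 10 * d + γ → dist s (y i) ≤ 13 / 10 * d - γ ∧ s ∈ Set.range t)) ∨ (∃ t : ↥Literature.Geometry.DiscreteGeometry.hcpKissingPattern → EuclideanSpace ℝ (Fin 3), 0 < d ∧ 0 < γ ∧ η < 1 / 20 ∧ (∀ u : ↥Literature.Geometry.DiscreteGeometry.hcpKissingPattern, t u ∈ (Set.range y) ∧ ‖(t u - (y i)) - d • A (u : EuclideanSpace ℝ (Fin 3))‖ ≤ η * d) ∧ (∀ s : EuclideanSpace ℝ (Fin 3), s ∈ (Set.range y) → s ≠ (y i) → d ≤ dist s (y i)) ∧ (∃ s : EuclideanSpace ℝ (Fin 3), s ∈ (Set.range y) ∧ s ≠ (y i) ∧ dist s (y i) ≤ d) ∧ (∀ s : EuclideanSpace ℝ (Fin 3), s ∈ (Set.range y) → s ≠ (y i) → dist s (y i) < 13 / 10 * d + γ → dist s (y i) ≤ 13 / 10 * d - γ ∧ s ∈ Set.range t))} : ℝ) ≤ Literature.MathematicalPhysics.StatisticalMechanics.interactionEnergy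 Literature.MathematicalPhysics.StatisticalMechanics.lennardJones y - N * (⨅ Q : Literature.MathematicalPhysics.StatisticalMechanics.PeriodicConfiguration 3, Q.energyPerParticle Literature.MathematicalPhysics.StatisticalMechanics.lennardJones) :=
  frustrationDensityGap_of_price_of_kr2 (by norm_num) le_rfl hη (chargedEnergyGap_iff_price.1 hgap) h2

/-- **`AperiodicFrustratedLawGap` (crux of item 27623) BY NAME from `MuEquilibriumDoor ∧ Price(θ) ∧ KR2(θ, η)`.** [folklore] -/
theorem aperiodicFrustratedLawGap_of_price_of_kr2 {θ η : ℝ} (hθ0 : 0 < θ) (hθ1 : θ ≤ 1 / 100) (hη : η < 1 / 20)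
    (hDoor : Summit.AtomisticToContinuum.Crystallization.Theses.GrainCoreNetworkSplit.MuEquilibriumDoor)
    (hprice : ∃ κ : ℝ, 0 < κ ∧ ∀ (N : ℕ) (y : Fin N → EuclideanSpace ℝ (Fin 3)), Function.Injective y → κ * (charged θ y : ℝ) ≤ interactionEnergy lennardJones y - (N : ℝ) * eStar)
    (h2 : ∀ (N : ℕ) (y : Fin N → EuclideanSpace ℝ (Fin 3)), Function.Injective y → (∀ a b : Fin N, a ≠ b → (7 : ℝ) / 10 ≤ dist (y a) (y b)) → ∀ i : Fin N, Literature.Geometry.DiscreteGeometry.IsChargeFree θ y i → (∀ j : Fin N, (Literature.Geometry.DiscreteGeometry.bondGraph θ y).Adj i j → Literature.Geometry.DiscreteGeometry.IsChargeFree θ y j) → ∃ A : EuclideanSpace ℝ (Fin 3) →ₗᵢ[ℝ] EuclideanSpace ℝ (Fin 3), ((∃ τ : ↥Literature.Geometry.DiscreteGeometry.fccKissingPattern → Fin N, (∀ u : ↥Literature.Geometry.DiscreteGeometry.fccKissingPattern, (Literature.Geometry.DiscreteGeometry.bondGraph θ y).Adj i (τ u)) ∧ (∀ k : Fin N, (Literature.Geometry.DiscreteGeometry.bondGraph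 θ y).Adj i k → ∃ u : ↥Literature.Geometry.DiscreteGeometry.fccKissingPattern, τ u = k) ∧ (∀ u : ↥Literature.Geometry.DiscreteGeometry.fccKissingPattern, ‖(y (τ u) - y i) - Literature.Geometry.DiscreteGeometry.nearestDist y i • A (u : EuclideanSpace ℝ (Fin 3))‖ ≤ η * Literature.Geometry.DiscreteGeometry.nearestDist y i)) ∨ (∃ τ : ↥Literature.Geometry.DiscreteGeometry.hcpKissingPattern → Fin N, (∀ u : ↥Literature.Geometry.DiscreteGeometry.hcpKissingPattern, (Literature.Geometry.DiscreteGeometry.bondGraph θ y).Adj i (τ u)) ∧ (∀ k : Fin N, (Literature.Geometry.DiscreteGeometry.bondGraph θ y).Adj i k → ∃ u : ↥Literature.Geometry.DiscreteGeometry.hcpKissingPattern, τ u = k) ∧ (∀ u : ↥Literature.Geometry.DiscreteGeometry.hcpKissingPattern, ‖(y (τ u) - y i) - Literature.Geometry.DiscreteGeometry.nearestDist y i • A (u : EuclideanSpace ℝ (Fin 3))‖ ≤ η * Literature.Geometry.DiscreteGeometry.nearestDist y i)))) :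
    Summit.AtomisticToContinuum.Crystallization.Theses.FrustratedLawDichotomy.AperiodicFrustratedLawGap :=
  aperiodicFrustratedLawGap_of_frustrationDensityGap hDoor (frustrationDensityGap_of_price_of_kr2 hθ0 hθ1 hη hprice h2)

/-- **The REGISTERED STUB `stub_aperiodicErgodicGap` (skeleton dd3251ad), verbatim, from `MuEquilibriumDoor ∧ Price(θ) ∧ KR2(θ, η)`.**
[folklore] -/
theorem aperiodicErgodicGap_of_price_of_kr2 {θ η : ℝ} (hθ0 : 0 < θ) (hθ1 : θ ≤ 1 / 100) (hη : η < 1 / 20)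
    (hDoor : Summit.AtomisticToContinuum.Crystallization.Theses.GrainCoreNetworkSplit.MuEquilibriumDoor)
    (hprice : ∃ κ : ℝ, 0 < κ ∧ ∀ (N : ℕ) (y : Fin N → EuclideanSpace ℝ (Fin 3)), Function.Injective y → κ * (charged θ y : ℝ) ≤ interactionEnergy lennardJones y - (N : ℝ) * eStar)
    (h2 : ∀ (N : ℕ) (y : Fin N → EuclideanSpace ℝ (Fin 3)), Function.Injective y → (∀ a b : Fin N, a ≠ b → (7 : ℝ) / 10 ≤ dist (y a) (y b)) → ∀ i : Fin N, Literature.Geometry.DiscreteGeometry.IsChargeFree θ y i → (∀ j : Fin N, (Literature.Geometry.DiscreteGeometry.bondGraph θ y).Adj i j → Literature.Geometry.DiscreteGeometry.IsChargeFree θ y j) → ∃ A : EuclideanSpace ℝ (Fin 3) →ₗᵢ[ℝ] EuclideanSpace ℝ (Fin 3), ((∃ τ : ↥Literature.Geometry.DiscreteGeometry.fccKissingPattern → Fin N, (∀ u : ↥Literature.Geometry.DiscreteGeometry.fccKissingPattern, (Literature.Geometry.DiscreteGeometry.bondGraph θ y).Adj i (τ u)) ∧ (∀ k : Fin N, (Literature.Geometry.DiscreteGeometry.bondGraph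 θ y).Adj i k → ∃ u : ↥Literature.Geometry.DiscreteGeometry.fccKissingPattern, τ u = k) ∧ (∀ u : ↥Literature.Geometry.DiscreteGeometry.fccKissingPattern, ‖(y (τ u) - y i) - Literature.Geometry.DiscreteGeometry.nearestDist y i • A (u : EuclideanSpace ℝ (Fin 3))‖ ≤ η * Literature.Geometry.DiscreteGeometry.nearestDist y i)) ∨ (∃ τ : ↥Literature.Geometry.DiscreteGeometry.hcpKissingPattern → Fin N, (∀ u : ↥Literature.Geometry.DiscreteGeometry.hcpKissingPattern, (Literature.Geometry.DiscreteGeometry.bondGraph θ y).Adj i (τ u)) ∧ (∀ k : Fin N, (Literature.Geometry.DiscreteGeometry.bondGraph θ y).Adj i k → ∃ u : ↥Literature.Geometry.DiscreteGeometry.hcpKissingPattern, τ u = k) ∧ (∀ u : ↥Literature.Geometry.DiscreteGeometry.hcpKissingPattern, ‖(y (τ u) - y i) - Literature.Geometry.DiscreteGeometry.nearestDist y i • A (u : EuclideanSpace ℝ (Fin 3))‖ ≤ η * Literature.Geometry.DiscreteGeometry.nearestDist y i)))) :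
    ∀ δ : ℝ, 0 < δ → ∀ P : MeasureTheory.Measure (MeasureTheory.Measure (EuclideanSpace ℝ (Fin 3))), let Gy : ℝ → (N : ℕ) → (Fin N → EuclideanSpace ℝ (Fin 3)) → Fin N → Prop := fun η N y j => let d : ℝ := sInf ((fun z => dist z (y (j : Fin N))) '' (Set.range (y) \ {(y (j : Fin N))})); let T : Set (EuclideanSpace ℝ (Fin 3)) := {z : EuclideanSpace ℝ (Fin 3) | z ∈ Set.range (y) ∧ z ≠ (y (j : Fin N)) ∧ dist z (y (j : Fin N)) < 13 / 10 * d}; ∃ A : EuclideanSpace ℝ (Fin 3) →ₗᵢ[ℝ] EuclideanSpace ℝ (Fin 3), (∃ e : ↥T ≃ ↥Literature.Geometry.DiscreteGeometry.fccKissingPattern, ∀ t : ↥T, dist (d⁻¹ • ((t : EuclideanSpace ℝ (Fin 3)) - (y (j : Fin N)))) (A ((e t : ↥Literature.Geometry.DiscreteGeometry.fccKissingPattern) : EuclideanSpace ℝ (Fin 3))) ≤ η) ∨ (∃ e : ↥T ≃ ↥Literature.Geometry.DiscreteGeometry.hcpKissingPattern, ∀ t : ↥T, dist (d⁻¹ •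 ((t : EuclideanSpace ℝ (Fin 3)) - (y (j : Fin N)))) (A ((e t : ↥Literature.Geometry.DiscreteGeometry.hcpKissingPattern) : EuclideanSpace ℝ (Fin 3))) ≤ η); let TexBall : (N : ℕ) → (Fin N → EuclideanSpace ℝ (Fin 3)) → Fin N → ℝ → ℝ → ℝ → ℝ → Prop := fun N y i R R₇ R₈ R₉ => (∀ a b : Fin N, a ≠ b → (7 : ℝ) / 10 ≤ dist (y a) (y b)) ∧ (∀ j : Fin N, dist (y j) (y i) ≤ R → ¬ Gy (1 / 20) N (y) j) ∧ (∀ j : Fin N, dist (y j) (y i) ≤ R → ¬ ((∀ j' : Fin N, dist (y j') (y j) ≤ R₇ → ¬ Gy (1 / 20) N (y) j') ∧ (∀ z : EuclideanSpace ℝ (Fin 3), dist z (y j) ≤ R₇ → ∃ k : Fin N, dist z (y k) ≤ 1) ∧ (∀ j' : Fin N, dist (y j') (y j) ≤ R₇ → (let d : ℝ := sInf ((fun z => dist z (y j')) '' (Set.range (y) \ {(y j')})); ∀ k : Fin N, y k ≠ y j' → dist (y k) (y j') < 27 / 20 * d → 5 ≤ Nat.card {m : Fin N // y m ≠ y j'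 ∧ dist (y m) (y j') < 27 / 20 * d ∧ y m ≠ y k ∧ dist (y m) (y k) < 27 / 20 * d})))) ∧ (∀ j : Fin N, dist (y j) (y i) ≤ R → ∃ k : Fin N, dist (y k) (y j) ≤ R₈ ∧ Gy (1 / 8) N (y) k) ∧ (∀ j : Fin N, dist (y j) (y i) ≤ R → ¬ ((∀ j' : Fin N, dist (y j') (y j) ≤ R₉ → ¬ Gy (1 / 20) N (y) j') ∧ (Nat.card {j' : Fin N // dist (y j') (y j) ≤ R₉ ∧ ¬ Gy (1 / 8) N (y) j'} : ℝ) ≤ 1 / 2 * (Nat.card {j' : Fin N // dist (y j') (y j) ≤ R₉} : ℝ) ∧ (∀ j' : Fin N, dist (y j') (y j) ≤ R₉ → ¬ Gy (1 / 8) N (y) j' → ¬ (let d : ℝ := sInf ((fun z => dist z (y j')) '' (Set.range (y) \ {(y j')})); ∀ k : Fin N, y k ≠ y j' → dist (y k) (y j') < 27 / 20 * d → 5 ≤ Nat.card {m : Fin N // y m ≠ y j' ∧ dist (y m) (y j') < 27 / 20 * d ∧ y m ≠ y k ∧ dist (y m) (y k) < 27 / 20 * d})))); let Appr : MeasureTheory.Measure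 (EuclideanSpace ℝ (Fin 3)) → ℝ → ℝ → ℝ → Prop := fun μ R₇ R₈ R₉ => ∀ q : EuclideanSpace ℝ (Fin 3), μ {q} ≠ 0 → ∀ R ε : ℝ, 0 < ε → ∃ (N : ℕ) (y : Fin N → EuclideanSpace ℝ (Fin 3)) (i : Fin N), TexBall N y i R R₇ R₈ R₉ ∧ (∀ p : EuclideanSpace ℝ (Fin 3), μ {p} ≠ 0 → dist p q ≤ R → ∃ k : Fin N, dist (y k - y i) (p - q) ≤ ε) ∧ (∀ k : Fin N, dist (y k) (y i) ≤ R → ∃ p : EuclideanSpace ℝ (Fin 3), μ {p} ≠ 0 ∧ dist (y k - y i) (p - q) ≤ ε); MeasureTheory.IsProbabilityMeasure P → (∀ᵐ μ ∂P, Literature.Probability.Process.IsRootedHardCore δ μ) → Literature.Probability.Process.IsPointStationaryLaw P → (∃ R₇ R₈ R₉ : ℝ, ∀ᵐ μ ∂P, Appr μ R₇ R₈ R₉) → (∀ᵐ μ ∂P, ∀ p : EuclideanSpace ℝ (Fin 3), μ {p} ≠ 0 → ∀ y : EuclideanSpace ℝ (Fin 3), (∀ q : EuclideanSpace ℝ (Fin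 3), μ {q} ≠ 0 → q ≠ p → y ≠ q) → ∑' q : {q : EuclideanSpace ℝ (Fin 3) // μ {q} ≠ 0 ∧ q ≠ p}, Literature.MathematicalPhysics.StatisticalMechanics.lennardJones (dist p (q : EuclideanSpace ℝ (Fin 3))) ≤ ∑' q : {q : EuclideanSpace ℝ (Fin 3) // μ {q} ≠ 0 ∧ q ≠ p}, Literature.MathematicalPhysics.StatisticalMechanics.lennardJones (dist y (q : EuclideanSpace ℝ (Fin 3)))) → P {μ : MeasureTheory.Measure (EuclideanSpace ℝ (Fin 3)) | ∃ Q : Literature.MathematicalPhysics.StatisticalMechanics.PeriodicConfiguration 3, ∃ t : EuclideanSpace ℝ (Fin 3), {p : EuclideanSpace ℝ (Fin 3) | μ {p} ≠ 0} = (fun s => s + t) '' Q.points} = 0 → (∀ A : Set (MeasureTheory.Measure (EuclideanSpace ℝ (Fin 3))), MeasurableSet A → (∀ μ : MeasureTheory.Measure (EuclideanSpace ℝ (Fin 3)), ∀ p : EuclideanSpace ℝ (Fin 3), μ {p} ≠ 0 → (μ ∈ A ↔ MeasureTheory.Measure.map (fun z : EuclideanSpace ℝ (Fin 3) => z - p)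 μ ∈ A)) → P A = 0 ∨ P Aᶜ = 0) → (⨅ Q : Literature.MathematicalPhysics.StatisticalMechanics.PeriodicConfiguration 3, Q.energyPerParticle Literature.MathematicalPhysics.StatisticalMechanics.lennardJones) < (∫ μ, Literature.MathematicalPhysics.StatisticalMechanics.rootEnergy Literature.MathematicalPhysics.StatisticalMechanics.lennardJones μ ∂P) :=
  aperiodicErgodicGap_of_frustrationDensityGap hDoor (frustrationDensityGap_of_price_of_kr2 hθ0 hθ1 hη hprice h2)

/-- **`NoFrustratedPeriodicMinimiser` (item 26654) from `Price(θ) ∧ KR2(θ, η)`, DOOR-FREE.** [folklore] -/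
theorem noFrustratedPeriodicMinimiser_of_price_of_kr2 {θ η : ℝ} (hθ0 : 0 < θ) (hθ1 : θ ≤ 1 / 100) (hη : η < 1 / 20)
    (hprice : ∃ κ : ℝ, 0 < κ ∧ ∀ (N : ℕ) (y : Fin N → EuclideanSpace ℝ (Fin 3)), Function.Injective y → κ * (charged θ y : ℝ) ≤ interactionEnergy lennardJones y - (N : ℝ) * eStar)
    (h2 : ∀ (N : ℕ) (y : Fin N → EuclideanSpace ℝ (Fin 3)), Function.Injective y → (∀ a b : Fin N, a ≠ b → (7 : ℝ) / 10 ≤ dist (y a) (y b)) → ∀ i : Fin N, Literature.Geometry.DiscreteGeometry.IsChargeFree θ y i → (∀ j : Fin N, (Literature.Geometry.DiscreteGeometry.bondGraph θ y).Adj i j → Literature.Geometry.DiscreteGeometry.IsChargeFree θ y j) → ∃ A : EuclideanSpace ℝ (Fin 3) →ₗᵢ[ℝ] EuclideanSpace ℝ (Fin 3), ((∃ τ : ↥Literature.Geometry.DiscreteGeometry.fccKissingPattern → Fin N, (∀ u : ↥Literature.Geometry.DiscreteGeometry.fccKissingPattern, (Literature.Geometry.DiscreteGeometry.bondGraph θ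 y).Adj i (τ u)) ∧ (∀ k : Fin N, (Literature.Geometry.DiscreteGeometry.bondGraph θ y).Adj i k → ∃ u : ↥Literature.Geometry.DiscreteGeometry.fccKissingPattern, τ u = k) ∧ (∀ u : ↥Literature.Geometry.DiscreteGeometry.fccKissingPattern, ‖(y (τ u) - y i) - Literature.Geometry.DiscreteGeometry.nearestDist y i • A (u : EuclideanSpace ℝ (Fin 3))‖ ≤ η * Literature.Geometry.DiscreteGeometry.nearestDist y i)) ∨ (∃ τ : ↥Literature.Geometry.DiscreteGeometry.hcpKissingPattern → Fin N, (∀ u : ↥Literature.Geometry.DiscreteGeometry.hcpKissingPattern, (Literature.Geometry.DiscreteGeometry.bondGraph θ y).Adj i (τ u)) ∧ (∀ k : Fin N, (Literature.Geometry.DiscreteGeometry.bondGraph θ y).Adj i k → ∃ u : ↥Literature.Geometry.DiscreteGeometry.hcpKissingPattern, τ u = k) ∧ (∀ u : ↥Literature.Geometry.DiscreteGeometry.hcpKissingPattern, ‖(y (τ u) - y i) - Literature.Geometry.DiscreteGeometry.nearestDist y i • A (u : EuclideanSpace ℝ (Fin 3))‖ ≤ η * Literature.Geometry.DiscreteGeometry.nearestDist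 y i)))) :
    Summit.AtomisticToContinuum.Crystallization.Theses.PeriodicChargeSplit.NoFrustratedPeriodicMinimiser :=
  noFrustratedPeriodicMinimiser_of_frustrationDensityGap (frustrationDensityGap_of_price_of_kr2 hθ0 hθ1 hη hprice h2)

end Summit.AtomisticToContinuum.Crystallization.Theorems.FrustratedLawDichotomyTwoShellRigidityDoorTol

end
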